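import Literature.Barriers.RiemannHypothesis.DeBrangesPositivity
import Literature.NumberTheory.LFunctions.ZetaCertifiedEvaluation
import Literature.Analysis.SpecialFunctions.DigammaStirlingSecondOrder
import Mathlib.NumberTheory.LSeries.Nonvanishing
import HarnessLib

/-!
# Certificate for Conrey–Li's numerical witness `Re{ξ(1+282i)/ξ(2+282i)} < 0`

Barrier catalogue `Literature/Barriers/RiemannHypothesis/`, sibling of `DeBrangesPositivity.lean`.
This file DISCHARGES the named fact `ConreyLi2000_FW_numeric` (Conrey–Li 2000, §3.1 eq. (3.4):
`Re{ξ(1 + 282i)/ξ(2 + 282i)} = −0.000131957 < 0`, a MATHEMATICA evaluation in the source; the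
printed witness for the failure `ConreyLi2000_FW` of de Branges' positivity condition (3.3) for
`𝓕(1/ξ(1−iz))`, whose non-numerical proof — Sarnak's, §4 Remark — is
`DeBrangesPositivityProofs.lean`) by a *certified computation inside Lean*: an executable
checker `ConreyLiCert.check : Bool` built on the tree's verified multi-precision interval
arithmetic, a soundness theorem
`ConreyLiCert.numeric_of_check : check = true → ConreyLi2000_FW_numeric`, and one compiled
evaluation `ConreyLiCert.check_eq_true` (`native_decide`; the only non-standard axiom of this file
is its auxiliary axiom — trust in the Lean compiler, the `Lean.ofReduceBool`/`Lean.trustCompiler`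
family — declared to the gate as `computational`, as for `MertensCertificate/Chunk*.lean`).

## The reduction (proved here)

With `s = 1 + 282i`, `w₀ = s/2 = ½ + 141i`, `w₁ = (s+1)/2 = 1 + 141i`, Mathlib's
`ξ(s) = ½ s(s−1) Λ(s)`, `Λ(s) = Γ_ℝ(s) ζ(s)`, `Γ_ℝ(s) = π^{−s/2} Γ(s/2)` give
`ξ(s)/ξ(s+1) = (s−1)/(s+1) · √π · Γ(w₀)/Γ(w₁) · ζ(s)/ζ(s+1)`. The `Γ`-ratio is the
only transcendental factor without an evaluator in the tree; by the second-order Stirling form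
`Γ(w₁) = Γ(w₀) exp(F(w₁) − F(w₀) + E)`, `F(w) = (w−½)Log w − w`,
`‖E‖ ≤ 1/(6·141³) + π/(12·141²) ≤ 1/70000`
(`Literature.Analysis.SpecialFunctions.Complex.Gamma_eq_mul_exp_stirlingPrim_horizontal`, from the
trapezoid-rule Stirling bounds for `Re ψ`, `Im ψ` on vertical lines), and since positive real
factors do not change the sign of a real part,

  `sign Re{ξ(s)/ξ(s+1)} = sign Re{(141 + i) · e^{iθ} · ζ(1+282i) · conj ζ(2+282i) · e^{−i Im E}}`,
  `θ = −Im(F(w₁) − F(w₀)) = −(½ Arg(1+141i) + 141 (log|1+141i| − log|½+141i|))`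
  `  = −((π/2 − arctan(1/141))/2 + 141 (log 19882 + 2 log 2 − log 79525)/2)`

(`xi_mul_conj_xi`, `theta_eq`). The checker encloses
`V = (141+i) e^{iθ} ζ(1+282i) conj ζ(2+282i)` in a box `W` (`MI.pi/atanInv/logNat/logTwo`,
`MC.expI`, and `zetaBox` = Euler–Maclaurin of order `ν = 20` with `N = 128` terms at scale
`2^110`, `ZetaCertifiedEvaluation.lean`) and accepts iff `hi(Re W) < 0` and
`70000 · hi(Re W) + 2 · absHi(Im W) < 0`, which implies `Re(V e^{iy}) < 0` for every
`|y| ≤ 1/70000` (`cos y ≥ ½`, `|sin y| ≤ |y|`; `re_neg_of_checkWith`). Numerically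
`ζ(1+282i) ≈ 0.5307 − 1.1801i`, `ζ(2+282i) ≈ 1.0877 − 0.4020i`, `θ ≈ −0.78451`,
`W ≈ −0.16762 − 211.57i`, i.e. `Re V/|V| ≈ −7.9·10⁻⁴` against the tolerance `2.9·10⁻⁵`;
with `|ξ(s)/ξ(s+1)| = 0.16656` this is the printed `Re = −1.3196·10⁻⁴`.

## Main results (namespace `Literature.Barriers.RiemannHypothesis`)

* `ConreyLiCert.check`, `ConreyLiCert.numeric_of_check` (soundness), `ConreyLiCert.check_eq_true`.
* `ConreyLi2000_FW_numeric_holds : ConreyLi2000_FW_numeric` (and hence, once more,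
  `ConreyLi2000_FW` via `ConreyLi2000_FW_of_numeric`; its name `ConreyLi2000_FW_holds` is taken by
  the non-numerical proof in `DeBrangesPositivityProofs.lean`).

## References

* [ConreyLi2000] J. B. Conrey, X.-J. Li, *A note on some positivity conditions related to zeta and
  L-functions*, IMRN 2000, no. 18, 929–940; arXiv:math/9812166, §3.1 eq. (3.4) and the Appendix
  (`g[t_]:=Re[xi[1+I*t]/xi[2+I*t]]`, `g[282.]`).
* [Edwards1974] H. M. Edwards, *Riemann's Zeta Function* (1974), §6.4 (Euler–Maclaurin for `ζ`).
-/

open Complex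
open Literature.NumberTheory.LFunctions (riemannXi riemannXi_eq_mul_completedRiemannZeta)
open Literature.Analysis.SpecialFunctions.Complex (stirlingPrim
  Gamma_eq_mul_exp_stirlingPrim_horizontal arg_eq_pi_div_two_sub_arctan)
open Literature.Analysis.ValidatedNumerics.NumericsMP
open Literature.NumberTheory.LFunctions.ZetaNumerics (Tables mkTables mkTables_valid zetaBox
  mem_zetaBox)
open scoped ComplexConjugate

namespace Literature.Barriers.RiemannHypothesis

namespace ConreyLiCert

/-! ## The reduction to a phase -/

/-- `w₀ = s/2 = ½ + 141 i` for `s = 1 + 282 i`. [cite: ConreyLi2000, §3.1 (3.4)] -/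
noncomputable def w₀ : ℂ := 1 / 2 + 141 * I

/-- `w₁ = (s+1)/2 = 1 + 141 i` for `s = 1 + 282 i`. [cite: ConreyLi2000, §3.1 (3.4)] -/
noncomputable def w₁ : ℂ := 1 + 141 * I

/-- `ΔF = F(w₁) − F(w₀)`, `F = stirlingPrim` (the Stirling main term of
`log Γ(w₁) − log Γ(w₀)`). [folklore] -/
noncomputable def deltaF : ℂ := stirlingPrim w₁ - stirlingPrim w₀

/-- The phase `θ = −Im ΔF` in closed form:
`−((π/2 − arctan(1/141))/2 + 141 (log 19882 + 2 log 2 − log 79525)/2)` (`theta_eq`).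
[folklore] -/
noncomputable def theta : ℝ :=
  -((Real.pi / 2 - Real.arctan (141 : ℝ)⁻¹) / 2 +
    (Real.log 19882 + Real.log 2 * 2 - Real.log 79525) * 141 / 2)

/-- `θ = −Im ΔF`: `Im F(w) = Re(w−½) Arg w + Im(w−½) log ‖w‖ − Im w`,
`Arg(1+141i) = π/2 − arctan(1/141)`, `log ‖1+141i‖ = ½ log 19882`,
`log ‖½+141i‖ = ½ (log 79525 − 2 log 2)`. [folklore] -/
theorem theta_eq : theta = -deltaF.im := by
  have harg : arg w₁ = Real.pi / 2 - Real.arctan (141 : ℝ)⁻¹ := by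
    rw [arg_eq_pi_div_two_sub_arctan (by simp [w₁]) (by simp [w₁])]
    simp [w₁]
  have hn₁ : Real.log ‖w₁‖ = Real.log 19882 / 2 := by
    have h2 : Real.log (‖w₁‖ ^ 2) = 2 * Real.log ‖w₁‖ := by
      rw [Real.log_pow]; norm_num
    have hsq : ‖w₁‖ ^ 2 = 19882 := by
      rw [Complex.sq_norm, Complex.normSq_apply]; simp [w₁]; norm_num
    rw [hsq] at h2
    linarith
  have hn₀ : Real.log ‖w₀‖ = (Real.log 79525 - 2 * Real.log 2) / 2 := by
    have h2 : Real.log (‖w₀‖ ^ 2) = 2 * Real.log ‖w₀‖ := by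
      rw [Real.log_pow]; norm_num
    have hsq : ‖w₀‖ ^ 2 = 79525 / 4 := by
      rw [Complex.sq_norm, Complex.normSq_apply]; simp [w₀]; norm_num
    have h4 : Real.log (4 : ℝ) = 2 * Real.log 2 := by
      rw [show (4 : ℝ) = 2 ^ 2 by norm_num, Real.log_pow]; norm_num
    rw [hsq, Real.log_div (by norm_num) (by norm_num), h4] at h2
    linarith
  have him₁ : (stirlingPrim w₁).im = arg w₁ / 2 + 141 * Real.log ‖w₁‖ - 141 := by
    simp only [stirlingPrim, Complex.sub_im, Complex.mul_im, Complex.log_re, Complex.log_im,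
      Complex.sub_re]
    simp [w₁]
    ring
  have him₀ : (stirlingPrim w₀).im = 141 * Real.log ‖w₀‖ - 141 := by
    simp only [stirlingPrim, Complex.sub_im, Complex.mul_im, Complex.log_re, Complex.log_im,
      Complex.sub_re]
    simp [w₀]
  rw [deltaF, Complex.sub_im, him₁, him₀, harg, hn₁, hn₀, theta]
  ring

/-- `cexp (conj z) = e^{Re z} · e^{−i Im z}`. [folklore] -/
lemma exp_conj_eq (z : ℂ) : cexp (conj z) = (Real.exp z.re : ℂ) * cexp (↑(-z.im) * I) := by
  rw [Complex.ofReal_exp, ← Complex.exp_add]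
  congr 1
  apply Complex.ext <;> simp

/-- **The reduction.** For `s = 1 + 282i` there are `E` with `‖E‖ ≤ 1/70000` (the Stirling
remainder of `log Γ(w₁) − log Γ(w₀)`) and a real `p > 0` with
`ξ(s) · conj ξ(s+1) = p · (141 + i) · e^{−i Im ΔF} · ζ(s) · conj ζ(s+1) · e^{−i Im E}`
(`ξ(s) = ½ s(s−1) π^{−s/2} Γ(s/2) ζ(s)`, `Γ(w₁) = Γ(w₀) e^{ΔF + E}`,
`π^{−(s+1)/2} = π^{−s/2} π^{−1/2}`, `(s−1) conj(s+1) = 564 (141 + i)`).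
[cite: ConreyLi2000, §3.1 (3.4)] -/
theorem xi_mul_conj_xi :
    ∃ E : ℂ, ‖E‖ ≤ 1 / 70000 ∧ ∃ p : ℝ, 0 < p ∧
      riemannXi (1 + 282 * I) * conj (riemannXi (2 + 282 * I)) =
        (p : ℂ) * ((141 + I) * cexp (↑(-deltaF.im) * I) * riemannZeta (1 + 282 * I) *
          conj (riemannZeta (2 + 282 * I)) * cexp (↑(-E.im) * I)) := by
  -- Stirling for `Γ(w₁)/Γ(w₀)`
  obtain ⟨E, hE, hΓ⟩ := Gamma_eq_mul_exp_stirlingPrim_horizontal (w₀ := w₀) (δ := 1 / 2)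
    (by simp [w₀]) (by simp [w₀]) (by norm_num)
  have hw : w₀ + ((1 / 2 : ℝ) : ℂ) = w₁ := by unfold w₀ w₁; push_cast; ring
  rw [hw] at hΓ
  have hΓ' : Gamma w₁ = Gamma w₀ * cexp (deltaF + E) := by rw [hΓ]; rfl
  have hEb : ‖E‖ ≤ 1 / 70000 := by
    refine hE.trans ?_
    have him : w₀.im = 141 := by simp [w₀]
    rw [him]
    have hπ := Real.pi_lt_d2
    have h1 : Real.pi / (12 * (141 : ℝ) ^ 2) ≤ 3.15 / (12 * (141 : ℝ) ^ 2) :=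
      div_le_div_of_nonneg_right hπ.le (by positivity)
    norm_num at h1 ⊢
    linarith
  -- the two values of `ξ`
  set s₁ : ℂ := 1 + 282 * I with hs₁
  set s₂ : ℂ := 2 + 282 * I with hs₂
  have hs₁0 : s₁ ≠ 0 := fun h ↦ by simpa [hs₁] using congrArg Complex.im h
  have hs₁1 : s₁ ≠ 1 := fun h ↦ by simpa [hs₁] using congrArg Complex.im h
  have hs₂0 : s₂ ≠ 0 := fun h ↦ by simpa [hs₂] using congrArg Complex.im h
  have hs₂1 : s₂ ≠ 1 := fun h ↦ by simpa [hs₂] using congrArg Complex.im h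
  have hΛ : ∀ s : ℂ, 0 < s.re → completedRiemannZeta s = Gammaℝ s * riemannZeta s := by
    intro s hs
    have h0 : s ≠ 0 := fun h ↦ by simp [h] at hs
    rw [riemannZeta_def_of_ne_zero h0, mul_div_cancel₀ _ (Gammaℝ_ne_zero_of_re_pos hs)]
  have hξ₁ : riemannXi s₁ =
      s₁ * (s₁ - 1) / 2 * ((Real.pi : ℂ) ^ (-s₁ / 2) * Gamma w₀) * riemannZeta s₁ := by
    rw [riemannXi_eq_mul_completedRiemannZeta hs₁0 hs₁1, hΛ s₁ (by simp [hs₁]),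
      Gammaℝ_def]
    have : s₁ / 2 = w₀ := by simp only [hs₁, w₀]; ring
    rw [this]; ring
  have hξ₂ : riemannXi s₂ =
      s₂ * (s₂ - 1) / 2 * ((Real.pi : ℂ) ^ (-s₂ / 2) * Gamma w₁) * riemannZeta s₂ := by
    rw [riemannXi_eq_mul_completedRiemannZeta hs₂0 hs₂1, hΛ s₂ (by simp [hs₂]),
      Gammaℝ_def]
    have : s₂ / 2 = w₁ := by simp only [hs₂, w₁]; ring
    rw [this]; ring
  -- `π^{-(s+1)/2} = π^{-s/2} · π^{-1/2}`
  have hπ0 : (Real.pi : ℂ) ≠ 0 := ofReal_ne_zero.2 Real.pi_ne_zero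
  set q : ℝ := Real.pi ^ (-(1 / 2) : ℝ) with hq
  have hq0 : 0 < q := Real.rpow_pos_of_pos Real.pi_pos _
  have hcpow : (Real.pi : ℂ) ^ (-s₂ / 2) = (Real.pi : ℂ) ^ (-s₁ / 2) * (q : ℂ) := by
    have e : -s₂ / 2 = -s₁ / 2 + (-(1 / 2) : ℂ) := by simp only [hs₁, hs₂]; ring
    rw [e, cpow_add _ _ hπ0, hq, ofReal_cpow Real.pi_pos.le]
    push_cast
    ring
  -- the common factor `C = (s/2) π^{-s/2} Γ(w₀)`
  set C : ℂ := s₁ / 2 * ((Real.pi : ℂ) ^ (-s₁ / 2) * Gamma w₀) with hC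
  have hCne : C ≠ 0 := by
    have hG : Gamma w₀ ≠ 0 := Complex.Gamma_ne_zero fun m h ↦ by
      have := congrArg Complex.im h
      simp [w₀] at this
    have hP : (Real.pi : ℂ) ^ (-s₁ / 2) ≠ 0 := fun h ↦ hπ0 ((cpow_eq_zero_iff _ _).1 h).1
    simp only [hC]
    exact mul_ne_zero (div_ne_zero hs₁0 two_ne_zero) (mul_ne_zero hP hG)
  have hξ₁' : riemannXi s₁ = C * ((s₁ - 1) * riemannZeta s₁) := by rw [hξ₁]; ring
  have hξ₂' :
      riemannXi s₂ = C * (s₂ * (q : ℂ) * cexp (deltaF + E) * riemannZeta s₂) := by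
    rw [hξ₂, hcpow, hΓ']
    have : s₂ - 1 = s₁ := by simp only [hs₁, hs₂]; ring
    rw [this]; ring
  -- numerals
  have h564 : (s₁ - 1) * conj s₂ = 564 * (141 + I) := by
    apply Complex.ext <;> simp [hs₁, hs₂] <;> norm_num
  -- the phases
  have hsplit : cexp (↑(-(deltaF + E).im) * I) =
      cexp (↑(-deltaF.im) * I) * cexp (↑(-E.im) * I) := by
    rw [← Complex.exp_add]
    congr 1
    push_cast
    simp only [Complex.add_im]
    push_cast
    ring
  refine ⟨E, hEb, Complex.normSq C * 564 * q * Real.exp ((deltaF + E).re),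
    mul_pos (mul_pos (mul_pos (Complex.normSq_pos.2 hCne) (by norm_num)) hq0) (Real.exp_pos _),
    ?_⟩
  calc riemannXi s₁ * conj (riemannXi s₂)
      = (C * conj C) * ((s₁ - 1) * conj s₂) * (q : ℂ) * cexp (conj (deltaF + E)) *
          (riemannZeta s₁ * conj (riemannZeta s₂)) := by
        rw [hξ₁', hξ₂']
        simp only [map_mul, Complex.conj_ofReal, ← Complex.exp_conj]
        ring
    _ = (Complex.normSq C : ℂ) * (564 * (141 + I)) * (q : ℂ) *
          ((Real.exp (deltaF + E).re : ℂ) *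
            (cexp (↑(-deltaF.im) * I) * cexp (↑(-E.im) * I))) *
          (riemannZeta s₁ * conj (riemannZeta s₂)) := by
        rw [Complex.mul_conj, h564, exp_conj_eq, hsplit]
    _ = _ := by
        push_cast
        ring

/-- `Re(z/w) = Re(z · conj w)/|w|²`. [folklore] -/
lemma div_re_eq (z w : ℂ) : (z / w).re = (z * conj w).re / Complex.normSq w := by
  rw [div_eq_mul_inv, Complex.inv_def, ← mul_assoc, Complex.re_mul_ofReal, div_eq_mul_inv]

/-! ## The checker -/

/-- Scale `2^110`. [folklore] -/
def SC : ℕ := 2 ^ 110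

/-- Euler–Maclaurin tables: `N = 128`, `ν = 20` (remainder `≈ (283/804)^{41} ≈ 10⁻¹⁸`), with
`π` and `log n` computed at scale `2^134` and rounded. [folklore] -/
def tables : Option Tables := mkTables SC 128 20 24 140 40 30 4 16 6

/-- The input box of `σ + 282 i` (a point). [folklore] -/
def sBox (T : Tables) (σ : ℤ) : MC := ⟨MI.ofInt T.S σ, MI.ofInt T.S 282⟩

/-- Enclosure of the phase `θ` (`theta`) from `π`, `arctan(1/141)`, `log 19882`, `log 79525`,
`log 2` (the logarithms and the arctangent at scale `2^24 · T.S`, rounded to `T.S`; the literal is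
written first so that `whnf` of these discriminants is not dragged into unary recursion on it).
[folklore] -/
def thetaBox (T : Tables) : Option MI :=
  let S' := 2 ^ 24 * T.S
  match MI.logNat S' 140 19882, MI.logNat S' 140 79525, MI.logTwo S' 140, MI.atanInv S' 40 141 with
  | some L1, some L0, some L2, some A =>
    some ((((((T.piI.divNat 2).sub (MI.rescale S' T.S A)).divNat 2).add
      (((((MI.rescale S' T.S L1).add ((MI.rescale S' T.S L2).mulInt 2)).sub
        (MI.rescale S' T.S L0)).mulInt 141).divNat 2))).neg)
  | _, _, _, _ => none

/-- Enclosure `W` of `V = (141 + i) · e^{iθ} · ζ(1+282i) · conj ζ(2+282i)`. [folklore] -/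
def wBox (T : Tables) : Option MC :=
  match thetaBox T, zetaBox T (sBox T 1), zetaBox T (sBox T 2) with
  | some Θ, some Z1, some Z2 =>
    match MC.expI T.S T.KI T.kI T.piI Θ with
    | some PH =>
      some (MC.mul T.S (MC.mul T.S (MC.mul T.S ⟨MI.ofInt T.S 141, MI.ofInt T.S 1⟩ PH) Z1)
        (MC.conj Z2))
    | none => none
  | _, _, _ => none

/-- The test on the box `W ∋ V`: `hi(Re W) < 0` and `70000 · hi(Re W) + 2 · absHi(Im W) < 0`.
[folklore] -/
def checkWith (T : Tables) : Bool :=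
  match wBox T with
  | some W => decide (W.re.hi < 0) && decide (W.re.hi * 70000 + 2 * W.im.absHi < 0)
  | none => false

/-- **The check** (made irreducible at the end of this file: never evaluate it by reduction).
[folklore] -/
def check : Bool := (tables.map checkWith).getD false

/-! ## Soundness -/

/-- `σ + 282 i ∈ sBox T σ`. [folklore] -/
lemma mem_sBox (T : Tables) (σ : ℤ) : MC.mem T.S ((σ : ℂ) + 282 * I) (sBox T σ) :=
  ⟨by simpa [sBox] using MI.mem_ofInt T.S σ, by simpa [sBox] using MI.mem_ofInt T.S 282⟩

/-- Soundness of `thetaBox`: `θ ∈ Θ`. [folklore] -/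
theorem mem_thetaBox {T : Tables} (hT : T.Valid) {Θ : MI} (h : thetaBox T = some Θ) :
    MI.mem T.S theta Θ := by
  unfold thetaBox at h
  simp only at h
  split at h
  · rename_i L1 L0 L2 A hL1 hL0 hL2 hA
    simp only [Option.some.injEq] at h
    subst h
    have hS := hT.S_pos
    have hS' : 0 < 2 ^ 24 * T.S := Nat.mul_pos (pow_pos (by norm_num) _) hS
    have m1 := MI.mem_rescale hS' T.S (MI.mem_logNat hS' hL1)
    have m0 := MI.mem_rescale hS' T.S (MI.mem_logNat hS' hL0)
    have m2 := MI.mem_rescale hS' T.S (MI.mem_logTwo hS' hL2)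
    have mA := MI.mem_rescale hS' T.S (MI.mem_atanInv _ hA)
    have hm := MI.mem_neg (MI.mem_add
      (MI.mem_divNat (MI.mem_sub (MI.mem_divNat hT.mem_pi two_pos) mA) two_pos)
      (MI.mem_divNat (MI.mem_mulInt (MI.mem_sub (MI.mem_add m1 (MI.mem_mulInt m2 2)) m0) 141)
        two_pos))
    convert hm using 2
    simp only [theta]
    push_cast
    ring
  · simp at h

/-- Soundness of `wBox`: `V ∈ W`. [folklore] -/
theorem mem_wBox {T : Tables} (hT : T.Valid) {W : MC} (h : wBox T = some W) :
    MC.mem T.S ((141 + I) * cexp (↑theta * I) * riemannZeta (1 + 282 * I) *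
      conj (riemannZeta (2 + 282 * I))) W := by
  unfold wBox at h
  split at h
  · rename_i Θ Z1 Z2 hΘ hZ1 hZ2
    split at h
    · rename_i PH hPH
      simp only [Option.some.injEq] at h
      subst h
      have hS := hT.S_pos
      have hθ := mem_thetaBox hT hΘ
      have hph := MC.mem_expI hS hT.mem_pi hPH hθ
      have hs1 : (1 : ℂ) + 282 * I ≠ 1 := fun h ↦ by simpa using congrArg Complex.im h
      have hs2 : (2 : ℂ) + 282 * I ≠ 1 := fun h ↦ by simpa using congrArg Complex.im h
      have hin1 : MC.mem T.S (1 + 282 * I) (sBox T 1) := by simpa using mem_sBox T 1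
      have hin2 : MC.mem T.S (2 + 282 * I) (sBox T 2) := by simpa using mem_sBox T 2
      have hz1 := mem_zetaBox hT hin1 hs1 hZ1
      have hz2 := mem_zetaBox hT hin2 hs2 hZ2
      have hC : MC.mem T.S (141 + I) ⟨MI.ofInt T.S 141, MI.ofInt T.S 1⟩ :=
        ⟨by simpa using MI.mem_ofInt T.S 141, by simpa using MI.mem_ofInt T.S 1⟩
      exact MC.mem_mul hS (MC.mem_mul hS (MC.mem_mul hS hC hph) hz1) (MC.mem_conj hz2)
    · simp at h
  · simp at h

/-- **The test implies the sign, uniformly in a small rotation**: if `checkWith T` accepts then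
`Re(V · e^{iy}) < 0` for all `|y| ≤ 1/70000` (`cos y ≥ ½`, `|sin y| ≤ |y|`). [folklore] -/
theorem re_neg_of_checkWith {T : Tables} (hT : T.Valid) (h : checkWith T = true) (y : ℝ)
    (hy : |y| ≤ 1 / 70000) :
    ((141 + I) * cexp (↑theta * I) * riemannZeta (1 + 282 * I) *
      conj (riemannZeta (2 + 282 * I)) * cexp (↑y * I)).re < 0 := by
  unfold checkWith at h
  split at h
  · rename_i W hW
    have hV := mem_wBox hT hW
    set V : ℂ := (141 + I) * cexp (↑theta * I) * riemannZeta (1 + 282 * I) *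
      conj (riemannZeta (2 + 282 * I)) with hVdef
    simp only [Bool.and_eq_true, decide_eq_true_eq] at h
    obtain ⟨h1, h2⟩ := h
    have hS : (0 : ℝ) < T.S := by exact_mod_cast hT.S_pos
    have hVre : V.re * T.S ≤ W.re.hi := hV.1.2
    have hVim : |V.im| * T.S ≤ W.im.absHi := MI.abs_le_absHi hV.2
    have h1r : (W.re.hi : ℝ) < 0 := by exact_mod_cast h1
    have h2r : (W.re.hi : ℝ) * 70000 + 2 * W.im.absHi < 0 := by exact_mod_cast h2
    have hcos : 1 / 2 ≤ Real.cos y := by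
      have hc := Real.one_sub_sq_div_two_le_cos (x := y)
      have hy1 : |y| ≤ 1 := hy.trans (by norm_num)
      have hy2 : y ^ 2 ≤ 1 := by
        have := abs_le.1 hy1
        nlinarith
      linarith
    have hsin : |Real.sin y| ≤ 1 / 70000 := Real.abs_sin_le_abs.trans hy
    have hVneg : V.re < 0 := by
      by_contra hge
      push Not at hge
      have := mul_nonneg hge hS.le
      linarith
    have hre : (V * cexp (↑y * I)).re = V.re * Real.cos y - V.im * Real.sin y := by
      rw [Complex.mul_re, Complex.exp_ofReal_mul_I_re, Complex.exp_ofReal_mul_I_im]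
    have a1 : V.re * Real.cos y * T.S ≤ W.re.hi / 2 := by
      have : V.re * Real.cos y ≤ V.re * (1 / 2) := mul_le_mul_of_nonpos_left hcos hVneg.le
      nlinarith
    have a2 : -(V.im * Real.sin y) * T.S ≤ W.im.absHi / 70000 := by
      have h3 : -(V.im * Real.sin y) ≤ |V.im| * (1 / 70000) :=
        calc -(V.im * Real.sin y) ≤ |V.im * Real.sin y| := neg_le_abs _
          _ = |V.im| * |Real.sin y| := abs_mul _ _
          _ ≤ |V.im| * (1 / 70000) := by gcongr
      nlinarith [abs_nonneg V.im]
    rw [hre]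
    by_contra hge
    push Not at hge
    have h4 : 0 ≤ (V.re * Real.cos y - V.im * Real.sin y) * T.S := mul_nonneg hge hS.le
    nlinarith
  · exact absurd h Bool.false_ne_true

/-- **Soundness of the certificate**: if `check` accepts then `Re{ξ(1+282i)/ξ(2+282i)} < 0`.
[cite: ConreyLi2000, §3.1 (3.4)] -/
theorem numeric_of_check (h : check = true) : ConreyLi2000_FW_numeric := by
  unfold check at h
  cases htab : tables with
  | none => simp [htab] at h
  | some T =>
    rw [htab] at h
    simp only [Option.map_some, Option.getD_some] at h
    have hT : T.Valid := mkTables_valid htab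
    obtain ⟨E, hE, p, hp, hkey⟩ := xi_mul_conj_xi
    have hy : |(-E.im)| ≤ 1 / 70000 := by
      rw [abs_neg]
      exact (Complex.abs_im_le_norm E).trans hE
    have hneg := re_neg_of_checkWith hT h (-E.im) hy
    rw [theta_eq] at hneg
    have hprod : (riemannXi (1 + 282 * I) * conj (riemannXi (2 + 282 * I))).re < 0 := by
      rw [hkey, Complex.re_ofReal_mul]
      exact mul_neg_of_pos_of_neg hp hneg
    have hξ₂ : riemannXi (2 + 282 * I) ≠ 0 := fun h0 ↦ by
      rw [h0, map_zero, mul_zero, Complex.zero_re] at hprod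
      exact lt_irrefl _ hprod
    unfold ConreyLi2000_FW_numeric
    rw [div_re_eq]
    exact div_neg_of_neg_of_pos hprod (Complex.normSq_pos.2 hξ₂)

attribute [irreducible] tables check

/-! ## The compiled evaluation -/

/-- **The certificate accepts**: one compiled evaluation (`native_decide`) of `check` — two
certified Euler–Maclaurin evaluations of `ζ` (`ζ(1+282i) ∈ 0.5307… − 1.1800…i`,
`ζ(2+282i) ∈ 1.0877… − 0.4019…i`), the phase `θ ∈ −0.78451…`, and the box
`W ∋ V`, `W ≈ −0.16762 − 211.57 i`, which passes both integer comparisons. The auxiliary axiom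
of `native_decide` (trust in the Lean compiler) is the only non-standard axiom; declared
`computational`. [cite: ConreyLi2000, §3.1 (3.4)] -/
theorem check_eq_true : check = true := by
  native_decide

end ConreyLiCert

/-- **Conrey–Li 2000, eq. (3.4), certified**: `Re{ξ(1 + 282i)/ξ(2 + 282i)} < 0` — the named
fact `ConreyLi2000_FW_numeric` DISCHARGED by the certificate `ConreyLiCert.check_eq_true` and its
soundness theorem `ConreyLiCert.numeric_of_check`. [cite: ConreyLi2000, §3.1 (3.4)] -/
theorem ConreyLi2000_FW_numeric_holds : ConreyLi2000_FW_numeric :=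
  ConreyLiCert.numeric_of_check ConreyLiCert.check_eq_true

end Literature.Barriers.RiemannHypothesis
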